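/-
Copyright (c) 2026. Released under the Apache 2.0 license.
-/
import Literature.NumberTheory.EllipticCurves.ManinConstantPlusPeriodCertificate
import HarnessLib

/-!
# An eighth source of `ClassAbsManinConstantEqOne W`: Cremona's PLUS-SPACE closeness datum (*) for
# ONE member `W₁` and a bound on the real periods of the class — the argument of Agashe–Ribet–Stein
# 2006, appendix (J. E. Cremona) §5, Prop. 5.1 / Thm. 5.4, PROVED in the tree's normalisation

Topic `Literature/NumberTheory/EllipticCurves`; namespace
`Literature.NumberTheory.EllipticCurves.ModularForms`. Two PREDICATES with a free curve argument
(hypothesis shapes; nothing is asserted, no named fact is introduced) and PROVED theorems only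
(D-0014 / D-0026), in the format of the sibling certificate files
`ManinConstantClassCertificate{Edixhoven,Kodaira,Twist,TwistCremonaRange,TwistLevelBound,…}.lean`.

## The printed argument (appendix §5, pp. 631–634)

Inputs (p. 631): `Λ_f` for the rational newform `f` ("known to a specific precision") and "a
complete isogeny class … `{E₁, …, E_m}` of conductor `N`, given by minimal models … So `E_f` is
isomorphic over `ℚ` to `E_{j₀}` for a unique `j₀`"; "Pulling back the Néron differential on
`E_{j₀}` to `X₀(N)` gives `c · 2πi f(z) dz` where `c ∈ ℤ` … Hence `cΛ_f = Λ_{j₀}`" (p. 632).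
Thm. 5.4 (p. 634, PLUS SPACE; the method of [Cre22] ¶ "Concerning the Manin constant" at every
level of the database): "We do not know the lattice `Λ_f` but only … a positive real number
`ω⁺_{1,f}` such that either `Λ_f` has type 1 and `ω_{1,f} = 2ω⁺_{1,f}`, or `Λ_f` has type 2 and
`ω_{1,f} = ω⁺_{1,f}`" (so `ω⁺_{1,f}` generates `re Λ_f`); "the ratio `λ = ω⁺_{1,1}/ω⁺_{1,f}`
satisfies `|λ − 1| < ε`. In all cases this holds with `ε = 1/3`" (the datum (*), L9–22); "If the
type of `Λ_f` is the same as that of `Λ₁` … `c = a_j = 1` … though there might be some ambiguity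
in which curve is optimal … `Λ₁` has type 1 but `Λ_f` has type 2 … `ca_j = 2` … `Λ₁` has type 2
but `Λ_f` has type 1 … `2ca_j = 1`, which is impossible" (L23–44). Inputs: `c ∈ ℤ` (Thm. 2.2 =
Edixhoven 1991 Prop. 2); for parity, `2 ∣ c ⇒ 2 ∣ N` (Thm. 2.5 = Abbes–Ullmo 1996 Thm. A).

## The tree's normalisation, and what is proved

`re Λ_E = ℤ · Ω(W)/2` for a globally minimal `W` with FULL Néron period `Ω(W) = W.realPeriodRat`
(components included; `ModularParametrizationData.exists_mem_lattice_re_eq_realPeriodRat_div_two`)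
and `re Λ_f = ℤ · Ω⁺_f/2` (`plusPeriod`). So `ω⁺_{1,j} = Ω(W_j)/2`, `ω⁺_{1,f} = Ω⁺_f/2`, the datum
(*) reads **`|Ω(W₁)/Ω⁺_f − 1| < ε`**, and for a lattice-OPTIMAL datum of a member `W'` the tree
PROVES **`Ω(W') = |c| · Ω⁺_f`** (`…realPeriodRat_eq_abs_mul_plusPeriod_of_latticeEq`). Hence
`|c| = (Ω(W')/Ω(W₁))·(Ω(W₁)/Ω⁺_f) < r(1+ε)` whenever `Ω(W') ≤ r·Ω(W₁)`; `r(1+ε) ≤ 2` forces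
`|c| = 1` (`c ≠ 0` as `Ω(W') > 0`), and `r(1+ε) ≤ 3` with `N` odd forces `|c| = 1` by Abbes–Ullmo.
The TYPE case analysis is absorbed: `Ω(W_j)/Ω(W₁) = (n_j/n₁)·(a₁/a_j)`, `n = #π₀(E(ℝ))` (`2` for
type 2, `1` for type 1), so with `a₁ = 1` "same type" gives `1/a_j ≤ 1`, "`Λ₁` type 1, `Λ_j` type 2"
gives `2/a_j` (`≤ 1` iff `a_j ≥ 2`; `= 2` iff `a_j = 1`, the undecided `c ∈ {1,2}` branch = the 48
classes of [Cre22] remark 1), "`Λ₁` type 2, `Λ_j` type 1" gives `1/(2a_j)`. Thus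
**`∀ j, Ω(W_j) ≤ Ω(W₁)`** is exactly the union of the printed cases concluding `c = 1` "whichever
curve is optimal". Declarations: `IsPlusPeriodCloseWithin ε W₁` (the datum (*), two-sided, for
every newform `f` of `W₁`); `IsRealPeriodRatioLe r W₁` (every globally minimal member has
`Ω(W') ≤ r·Ω(W₁)` — exact class data: completeness of the class, p. 631 input (3), and rational
period ratios, `SkinnerUrban2014.exists_int_mul_realPeriodRat_eq_of_isogeny`);
`IsPlusPeriodWindowCovered W₁` (`ε = 1/3`, `r = 1`); PROVED
`abs_maninConstant_lt_of_plusPeriod_window` (`|c| < r(1+ε)`), the constructors of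
`ClassAbsManinConstantEqOne W₁` for `r(1+ε) ≤ 2`, for the road's name, and for `r(1+ε) ≤ 3`
with `2 ∤ N(W₁)` (displaying the EXISTING facts
`abbesUllmo_not_dvd_maninConstant_of_not_dvd_level` and `exists_isNewformOf`). NOT here: no Manin
constant is asserted; nothing about WHICH member is optimal; no `a_j`, `b_j`, no Stevens curve;
Prop. 5.1's full-lattice form is not restated (its real half is the case `r(1+ε) ≤ 2`). The tier of
the datum (*) (print for `N < 130000`; [Cre22] for `N ≤ 500000`; or a per-level two-engine
computation) is the referee's, not this file's.

## Relation to `ManinConstantPlusPeriodCertificate.lean` (PRIORITY) — this file is its front end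

The sibling `ManinConstantPlusPeriodCertificate.lean` (cell `bsd-litref/manin`, typer seat; landed
FIRST, 2026-08-27) proves the same Ω-normalised argument with the ONE-PIECE class predicate
`PlusPeriodClassBound W u` ("every globally minimal member has `Ω(W') < u·Ω⁺_f`") and the fact-free
`classAbsManinConstantEqOne_of_plusPeriodClassBound_two`; it has PRIORITY and is the by-name object
of record. This file, written in parallel by the reader seat, duplicates the core inequality and
adds only the TWO-PIECE display (datum (*) verbatim, two-sided, `ε` explicit, with the
interval-decoding constructor `isPlusPeriodCloseWithin_of_bounds`; exact class side separate), the
windows `r(1+ε) ≤ 2 / ≤ 3`, and the certificate-row corollary. §"Bridge" below makes them one story: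
`plusPeriodClassBound_of_isPlusPeriodCloseWithin_of_isRealPeriodRatioLe` (`r(1+ε) ≤ u`),
`IsPlusPeriodWindowCovered.plusPeriodClassBound_two`, and the road's constructor re-derived through
the sibling (`classAbsManinConstantEqOne_of_isPlusPeriodWindowCovered'`); consumers should display
`PlusPeriodClassBound W 2` and may build it from the two-piece data here.

## References
* [AgasheRibetStein2006] A. Agashe, K. Ribet, W. A. Stein, *The Manin constant*, with an appendix
  by J. E. Cremona, Pure Appl. Math. Q. 2 (2006) no. 2, 617–636: Thm. 2.2, Thm. 2.5 (p. 619);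
  appendix §5 pp. 631–634: inputs (p. 631), (*) and `cΛ_f = Λ_{j₀}` (p. 632), Prop. 5.1
  (pp. 632–633),
  Thm. 5.4 and its proof (p. 634, L7–49).
* [Cremona2022ManinConstants] J. E. Cremona, *Manin constants and optimal curves*,
  `ecdata/manin.txt`: ¶1, ¶ "Concerning the Manin constant", Additional remark 1 (48 classes).
* [CremonaAlgorithms1997] §2.8; [EdixhovenManin1991] §1, Prop. 2; [AbbesUllmo1996] Thm. A.
-/

noncomputable section

open scoped MatrixGroups ModularForm

open CongruenceSubgroup WeierstrassCurve

namespace Literature.NumberTheory.EllipticCurves.ModularForms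

/-! ### The two predicates and the road's name -/

/-- **Cremona's plus-space closeness datum (*) for the curve `W₁`, within `ε`**: for every
newform `f` of `W₁` (weight `2` on some `Γ₀(N)`, `aₙ(f) = aₙ(W₁)`), the full real period
`Ω(W₁)` of the model `W₁` and the real period `Ω⁺_f` of `f` (`re Λ_f = ℤ·Ω⁺_f/2`) satisfy
`|Ω(W₁)/Ω⁺_f − 1| < ε`. In the appendix's notation `Ω(W₁)/Ω⁺_f = ω⁺_{1,1}/ω⁺_{1,f} = λ` and this
is "(*) … `|λ − 1| < ε`. In all cases this holds with `ε = 1/3`" (Thm. 5.4, proof, p. 634 L9–22;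
Prop. 5.1 uses `ε = B⁻¹`). A predicate — the SHAPE of one per-class datum (one real number, the
generator of `re Λ_f`, against `Ω(W₁)`); nothing is asserted and no tier is implied.
[cite: AgasheRibetStein2006, appendix §5, (*) p. 632 and Thm. 5.4 proof p. 634 L9–22] -/
def IsPlusPeriodCloseWithin (ε : ℝ) (W₁ : WeierstrassCurve ℚ) : Prop :=
  ∀ {N : ℕ} [NeZero N] (f : CuspForm (Gamma0 N) 2), IsNewformOf W₁ f →
    |W₁.realPeriodRat / plusPeriod f - 1| < ε

/-- **The class-side bound**: every globally minimal member `W'` of the isogeny class of `W₁` has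
full real period `Ω(W') ≤ r · Ω(W₁)`. In the appendix's notation
`Ω(W_j)/Ω(W₁) = (n_j/n₁)·(a₁/a_j)` (`n` = number of real components = `2` for lattice type 2, `1`
for type 1; `a_j = ω_{1,j₁}/ω_{1,j} ∈ ℕ`, p. 632 L45–50), so `r = 1` with `a₁ = 1` is the union of
the printed cases "same type" / "`Λ₁` type 1, `Λ_j` type 2 with `a_j ≥ 2`" / "`Λ₁` type 2, `Λ_j`
type 1" of Thm. 5.4's proof (p. 634 L23–44). Exact per-class data (the complete class,
appendix p. 631 input (3), and the rational ratios of Néron periods under `ℚ`-isogenies,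
`SkinnerUrban2014.exists_int_mul_realPeriodRat_eq_of_isogeny`); a predicate, nothing asserted.
[cite: AgasheRibetStein2006, appendix §5, p. 631 input (3) and p. 634 L23–44] -/
def IsRealPeriodRatioLe (r : ℚ) (W₁ : WeierstrassCurve ℚ) : Prop :=
  ∀ (W' : WeierstrassCurve ℚ) [W'.IsElliptic] [W'.IsGloballyMinimal], IsIsogenous W₁ W' →
    W'.realPeriodRat ≤ (r : ℝ) * W₁.realPeriodRat

/-- **The "plus-period-window covered" classes** (the road's name, format of the sibling
certificates): the datum (*) holds for `W₁` with the printed `ε = 1/3` AND `W₁` has the largest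
full real period among the globally minimal members of its class (`r = 1`). A predicate; nothing
asserted. [cite: AgasheRibetStein2006, appendix Thm. 5.4 and its proof, p. 634 L7–44] -/
def IsPlusPeriodWindowCovered (W₁ : WeierstrassCurve ℚ) : Prop :=
  IsPlusPeriodCloseWithin (1 / 3) W₁ ∧ IsRealPeriodRatioLe 1 W₁

/-- Unfolding of `IsPlusPeriodCloseWithin` (by `Iff.rfl`).
[cite: AgasheRibetStein2006, appendix §5, (*) p. 632] -/
theorem isPlusPeriodCloseWithin_iff (ε : ℝ) (W₁ : WeierstrassCurve ℚ) :
    IsPlusPeriodCloseWithin ε W₁ ↔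
      ∀ {N : ℕ} [NeZero N] (f : CuspForm (Gamma0 N) 2), IsNewformOf W₁ f →
        |W₁.realPeriodRat / plusPeriod f - 1| < ε :=
  Iff.rfl

/-- Unfolding of `IsRealPeriodRatioLe` (by `Iff.rfl`).
[cite: AgasheRibetStein2006, appendix §5, p. 631 input (3)] -/
theorem isRealPeriodRatioLe_iff (r : ℚ) (W₁ : WeierstrassCurve ℚ) :
    IsRealPeriodRatioLe r W₁ ↔
      ∀ (W' : WeierstrassCurve ℚ) [W'.IsElliptic] [W'.IsGloballyMinimal], IsIsogenous W₁ W' →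
        W'.realPeriodRat ≤ (r : ℝ) * W₁.realPeriodRat :=
  Iff.rfl

/-- Unfolding of `IsPlusPeriodWindowCovered` (by `Iff.rfl`).
[cite: AgasheRibetStein2006, appendix Thm. 5.4] -/
theorem isPlusPeriodWindowCovered_iff (W₁ : WeierstrassCurve ℚ) :
    IsPlusPeriodWindowCovered W₁ ↔ IsPlusPeriodCloseWithin (1 / 3) W₁ ∧ IsRealPeriodRatioLe 1 W₁ :=
  Iff.rfl

/-- Monotonicity of the datum in `ε`. [cite: AgasheRibetStein2006, appendix §5, (*) p. 632] -/
theorem IsPlusPeriodCloseWithin.mono {ε ε' : ℝ} {W₁ : WeierstrassCurve ℚ}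
    (h : IsPlusPeriodCloseWithin ε W₁) (hle : ε ≤ ε') : IsPlusPeriodCloseWithin ε' W₁ :=
  fun f hf ↦ (h f hf).trans_le hle

/-- Monotonicity of the class-side bound in `r`.
[cite: AgasheRibetStein2006, appendix §5, p. 631 input (3)] -/
theorem IsRealPeriodRatioLe.mono {r r' : ℚ} {W₁ : WeierstrassCurve ℚ} [W₁.IsElliptic]
    (h : IsRealPeriodRatioLe r W₁) (hle : r ≤ r') : IsRealPeriodRatioLe r' W₁ := by
  intro W' _ _ hiso
  have hΩ₁ : 0 < W₁.realPeriodRat := by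
    haveI : (W₁.baseChange ℝ).IsElliptic := by
      rw [WeierstrassCurve.baseChange]; infer_instance
    exact (W₁.baseChange ℝ).realPeriod_pos'
  have hle' : (r : ℝ) ≤ (r' : ℝ) := by exact_mod_cast hle
  exact (h W' hiso).trans (mul_le_mul_of_nonneg_right hle' hΩ₁.le)

/-- The two-sided datum from one-sided bounds: if `lo ≤ Ω(W₁)/Ω⁺_f ≤ hi` for every newform `f` of
`W₁` with `1 − ε < lo` and `hi < 1 + ε`, then (*) holds within `ε` (the shape in which an interval
computation of `Ω⁺_f` certifies the datum). [cite: AgasheRibetStein2006, appendix §5, (*) p. 632] -/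
theorem isPlusPeriodCloseWithin_of_bounds {ε lo hi : ℝ} {W₁ : WeierstrassCurve ℚ}
    (hlo : 1 - ε < lo) (hhi : hi < 1 + ε)
    (h : ∀ {N : ℕ} [NeZero N] (f : CuspForm (Gamma0 N) 2), IsNewformOf W₁ f →
      lo ≤ W₁.realPeriodRat / plusPeriod f ∧ W₁.realPeriodRat / plusPeriod f ≤ hi) :
    IsPlusPeriodCloseWithin ε W₁ := by
  intro N _ f hf
  obtain ⟨h1, h2⟩ := h f hf
  rw [abs_sub_lt_iff]
  constructor <;> linarith

/-! ### The window inequality (the "usual argument" of the appendix, real projection) -/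

/-- **The window inequality.** Let `D'` be a lattice-OPTIMAL parametrisation datum
(`Λ_{W'} = c·Λ_f`, the clause `hopt`) of a globally minimal elliptic `W'` isogenous to `W₁`, let
the datum (*) hold for `W₁` within `ε`, and let `Ω(W') ≤ r·Ω(W₁)`. Then `|c| < r · (1 + ε)`:
indeed `Ω(W') = |c|·Ω⁺_f` exactly
(`ModularParametrizationData.realPeriodRat_eq_abs_mul_plusPeriod_of_latticeEq`; `f = D'.f` is a
newform of `W₁` since isogenous curves share their newform), and `Ω(W₁) < (1+ε)·Ω⁺_f` by (*), so
`|c|·Ω⁺_f = Ω(W') ≤ r·Ω(W₁) < r(1+ε)·Ω⁺_f` with `Ω⁺_f > 0`. This is the computation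
"`c = (ω⁺_{1,j}/ω⁺_{1,1})·λ`" of the proofs of Prop. 5.1 (p. 633 L8–37) and Thm. 5.4 (p. 634
L23–44). [cite: AgasheRibetStein2006, appendix Prop. 5.1 proof p. 633 and Thm. 5.4 proof p. 634] -/
theorem abs_maninConstant_lt_of_plusPeriod_window {ε : ℝ} {r : ℚ}
    {W₁ : WeierstrassCurve ℚ} [W₁.IsElliptic] (hstar : IsPlusPeriodCloseWithin ε W₁)
    {W' : WeierstrassCurve ℚ} [W'.IsElliptic] [W'.IsGloballyMinimal] {N' : ℕ} [NeZero N']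
    (D' : ModularParametrizationData W' N') (hiso : IsIsogenous W₁ W')
    (hopt : ∀ z ∈ D'.L.lattice, ∃ w ∈ periodLattice D'.f, z = D'.c * w)
    (hratio : W'.realPeriodRat ≤ (r : ℝ) * W₁.realPeriodRat) :
    |(D'.maninConstant : ℝ)| < (r : ℝ) * (1 + ε) := by
  have hf : IsNewformOf W₁ D'.f := D'.isNewformOf.of_isIsogenous hiso
  have hplus : 0 < plusPeriod D'.f :=
    IsNewform0.plusPeriod_pos_holds D'.isNewformOf.1 D'.isNewformOf.coeffField_eq_bot
  have hΩ' : 0 < W'.realPeriodRat := by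
    haveI : (W'.baseChange ℝ).IsElliptic := by
      rw [WeierstrassCurve.baseChange]; infer_instance
    exact (W'.baseChange ℝ).realPeriod_pos'
  have hΩ₁ : 0 < W₁.realPeriodRat := by
    haveI : (W₁.baseChange ℝ).IsElliptic := by
      rw [WeierstrassCurve.baseChange]; infer_instance
    exact (W₁.baseChange ℝ).realPeriod_pos'
  -- `Ω(W') = |c| Ω⁺_f` exactly (lattice-optimal datum)
  have heq : W'.realPeriodRat = |(D'.c : ℝ)| * plusPeriod D'.f :=
    D'.realPeriodRat_eq_abs_mul_plusPeriod_of_latticeEq hopt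
  -- (*) : `Ω(W₁) < (1 + ε) Ω⁺_f`
  have h1 : W₁.realPeriodRat / plusPeriod D'.f - 1 < ε := (abs_sub_lt_iff.mp (hstar D'.f hf)).1
  have h2 : W₁.realPeriodRat < (1 + ε) * plusPeriod D'.f := by
    have : W₁.realPeriodRat / plusPeriod D'.f < 1 + ε := by linarith
    exact (div_lt_iff₀ hplus).mp this
  -- `r > 0` (because `0 < Ω(W') ≤ r Ω(W₁)`)
  have hr : 0 < (r : ℝ) := by
    by_contra hle
    have : (r : ℝ) * W₁.realPeriodRat ≤ 0 :=
      mul_nonpos_of_nonpos_of_nonneg (not_lt.mp hle) hΩ₁.le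
    linarith
  have h3 : |(D'.c : ℝ)| * plusPeriod D'.f < ((r : ℝ) * (1 + ε)) * plusPeriod D'.f := by
    calc |(D'.c : ℝ)| * plusPeriod D'.f = W'.realPeriodRat := heq.symm
      _ ≤ (r : ℝ) * W₁.realPeriodRat := hratio
      _ < (r : ℝ) * ((1 + ε) * plusPeriod D'.f) := mul_lt_mul_of_pos_left h2 hr
      _ = ((r : ℝ) * (1 + ε)) * plusPeriod D'.f := by ring
  have h4 : |(D'.c : ℝ)| < (r : ℝ) * (1 + ε) := lt_of_mul_lt_mul_right h3 hplus.le
  simpa [ModularParametrizationData.maninConstant] using h4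

/-- Under the same optimality clause the Manin constant is nonzero: `Ω(W') = |c|·Ω⁺_f` with
`Ω(W') > 0`. (Also a field-free consequence of `Λ_{W'} = cΛ_f` with `Λ_{W'} ≠ 0`.)
[cite: EdixhovenManin1991, §1] -/
theorem abs_maninConstant_pos_of_latticeEq {W' : WeierstrassCurve ℚ} [W'.IsElliptic]
    {N' : ℕ} [NeZero N'] (D' : ModularParametrizationData W' N')
    (hopt : ∀ z ∈ D'.L.lattice, ∃ w ∈ periodLattice D'.f, z = D'.c * w) :
    0 < |D'.maninConstant| := by
  have hΩ' : 0 < W'.realPeriodRat := by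
    haveI : (W'.baseChange ℝ).IsElliptic := by
      rw [WeierstrassCurve.baseChange]; infer_instance
    exact (W'.baseChange ℝ).realPeriod_pos'
  have heq : W'.realPeriodRat = |(D'.c : ℝ)| * plusPeriod D'.f :=
    D'.realPeriodRat_eq_abs_mul_plusPeriod_of_latticeEq hopt
  have hc : (D'.c : ℝ) ≠ 0 := by
    intro h0
    rw [h0, abs_zero, zero_mul] at heq
    exact hΩ'.ne' heq
  have hc' : D'.c ≠ 0 := by exact_mod_cast hc
  simpa [ModularParametrizationData.maninConstant] using abs_pos.mpr hc'

/-! ### The constructors of `ClassAbsManinConstantEqOne` -/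

/-- **Agashe–Ribet–Stein 2006, appendix Prop. 5.1 / Thm. 5.4 (Cremona), the window `r(1+ε) ≤ 2`,
per class.** If the plus-space datum (*) holds for `W₁` within `ε` and every globally minimal member
`W'` of the class has `Ω(W') ≤ r·Ω(W₁)` with `r(1+ε) ≤ 2`, then the optimal curve of the class —
whichever member it is — has Manin constant `±1`: for every globally minimal `W'` isogenous to `W₁`
and every lattice-optimal datum `D'` of `W'`, `0 < |c| < r(1+ε) ≤ 2`, so `|c| = 1` ("we deduce as
before that … `c = a_j = 1` … though there might be some ambiguity in which curve is optimal",
p. 634 L26–29). [cite: AgasheRibetStein2006, appendix Prop. 5.1 and Thm. 5.4 (proof p. 634 L23–44)] -/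
theorem classAbsManinConstantEqOne_of_isPlusPeriodCloseWithin_of_isRealPeriodRatioLe
    {ε : ℝ} {r : ℚ} (hεr : (r : ℝ) * (1 + ε) ≤ 2)
    (W₁ : WeierstrassCurve ℚ) [W₁.IsElliptic]
    (hstar : IsPlusPeriodCloseWithin ε W₁) (hratio : IsRealPeriodRatioLe r W₁) :
    ClassAbsManinConstantEqOne W₁ := by
  intro W' _ _ N' _ D' hiso hopt
  have hlt : |(D'.maninConstant : ℝ)| < 2 :=
    (abs_maninConstant_lt_of_plusPeriod_window hstar D' hiso hopt (hratio W' hiso)).trans_le hεr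
  have hlt' : |D'.maninConstant| < 2 := by exact_mod_cast hlt
  have hpos : 0 < |D'.maninConstant| := abs_maninConstant_pos_of_latticeEq D' hopt
  omega

/-- **The road by name**: `IsPlusPeriodWindowCovered W₁ → ClassAbsManinConstantEqOne W₁` — the
printed `ε = 1/3` of Thm. 5.4 with "curve `W₁` has the largest full real period in its class"
(`r = 1`, `r(1+ε) = 4/3 ≤ 2`). The class predicate then transfers to every member
(`ClassAbsManinConstantEqOne.of_isIsogenous`) and yields the consumers' binders
`¬ (p : ℤ) ∣ D'.maninConstant` at EVERY prime (`ClassAbsManinConstantEqOne.not_dvd_maninConstant`).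
[cite: AgasheRibetStein2006, appendix Thm. 5.4 (p. 634 L7–44)] -/
theorem classAbsManinConstantEqOne_of_isPlusPeriodWindowCovered
    (W₁ : WeierstrassCurve ℚ) [W₁.IsElliptic] (h : IsPlusPeriodWindowCovered W₁) :
    ClassAbsManinConstantEqOne W₁ :=
  classAbsManinConstantEqOne_of_isPlusPeriodCloseWithin_of_isRealPeriodRatioLe
    (ε := 1 / 3) (r := 1) (by norm_num) W₁ h.1 h.2

/-- **The odd-level refinement (the window `r(1+ε) ≤ 3`)**: "for 15 of these the level `N` is odd,
so we know that `c` must be odd" (p. 634 L34–35; Abbes–Ullmo 1996 Thm. A = Thm. 2.5: `2 ∣ c ⇒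
2 ∣ N`). If (*) holds for `W₁` within `ε`, every globally minimal member has `Ω(W') ≤ r·Ω(W₁)` with
`r(1+ε) ≤ 3`, and the conductor `N(W₁)` is odd, then `0 < |c| < 3` and `2 ∤ c`, so `|c| = 1`. The
Abbes–Ullmo input is DISPLAYED as the existing tree fact
`abbesUllmo_not_dvd_maninConstant_of_not_dvd_level` (`p ∤ N' ⇒ p ∤ c`), and modularity
`exists_isNewformOf` identifies the level `N'` of the datum with `N(W₁)`
(`level_eq_conductorNorm_of_isIsogenous`). In the `r = 2` instance this covers the printed
configuration "`Λ₁` type 1, some `Λ_j` of type 2 with `a_j = 1`, `N` odd".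
[cite: AgasheRibetStein2006, Thm. 2.5 and appendix Thm. 5.4 proof p. 634 L30–35]
[cite: AbbesUllmo1996, Thm. A] -/
theorem classAbsManinConstantEqOne_of_isPlusPeriodCloseWithin_of_isRealPeriodRatioLe_of_odd
    (hAU : abbesUllmo_not_dvd_maninConstant_of_not_dvd_level) (hnf : exists_isNewformOf)
    {ε : ℝ} {r : ℚ} (hεr : (r : ℝ) * (1 + ε) ≤ 3)
    (W₁ : WeierstrassCurve ℚ) [W₁.IsElliptic] (hodd : ¬ 2 ∣ W₁.conductorNorm ℤ)
    (hstar : IsPlusPeriodCloseWithin ε W₁) (hratio : IsRealPeriodRatioLe r W₁) :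
    ClassAbsManinConstantEqOne W₁ := by
  intro W' _ _ N' _ D' hiso hopt
  have hlt : |(D'.maninConstant : ℝ)| < 3 :=
    (abs_maninConstant_lt_of_plusPeriod_window hstar D' hiso hopt (hratio W' hiso)).trans_le hεr
  have hlt' : |D'.maninConstant| < 3 := by exact_mod_cast hlt
  have hpos : 0 < |D'.maninConstant| := abs_maninConstant_pos_of_latticeEq D' hopt
  have hN' : ¬ 2 ∣ N' := (level_eq_conductorNorm_of_isIsogenous hnf D' hiso) ▸ hodd
  have h2 : ¬ (2 : ℤ) ∣ D'.maninConstant := by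
    exact_mod_cast hAU W' D' hopt 2 Nat.prime_two hN'
  have h2' : ¬ (2 : ℤ) ∣ |D'.maninConstant| := fun h ↦ h2 ((dvd_abs _ _).mp h)
  have hne : |D'.maninConstant| ≠ 2 := fun h ↦ h2' (by rw [h])
  omega

/-- The odd-level road at the printed `ε = 1/3` with `r = 2` (`r(1+ε) = 8/3 ≤ 3`): (*) for `W₁`,
every globally minimal member has `Ω(W') ≤ 2·Ω(W₁)`, and `N(W₁)` is odd ⟹
`ClassAbsManinConstantEqOne W₁`, displaying `hAU` and `hnf`.
[cite: AgasheRibetStein2006, appendix Thm. 5.4 proof p. 634 L30–35] [cite: AbbesUllmo1996, Thm. A] -/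
theorem classAbsManinConstantEqOne_of_isPlusPeriodCloseWithin_third_of_isRealPeriodRatioLe_two_of_odd
    (hAU : abbesUllmo_not_dvd_maninConstant_of_not_dvd_level) (hnf : exists_isNewformOf)
    (W₁ : WeierstrassCurve ℚ) [W₁.IsElliptic] (hodd : ¬ 2 ∣ W₁.conductorNorm ℤ)
    (hstar : IsPlusPeriodCloseWithin (1 / 3) W₁) (hratio : IsRealPeriodRatioLe 2 W₁) :
    ClassAbsManinConstantEqOne W₁ :=
  classAbsManinConstantEqOne_of_isPlusPeriodCloseWithin_of_isRealPeriodRatioLe_of_odd hAU hnf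
    (ε := 1 / 3) (r := 2) (by norm_num) W₁ hodd hstar hratio

/-- **Certificate rows from the window**: if moreover `W₁` itself carries a lattice-optimal datum at
the conductor level (`IsOptimalModel W₁`), the class carries a full certificate row
`OptimalCurveManinCertificate W₁` ("`j₀ = 1` and `c = 1`", Prop. 5.1's conclusion; the optimality
half is the hypothesis, as everywhere in the tree). [cite: AgasheRibetStein2006, appendix Prop. 5.1] -/
theorem optimalCurveManinCertificate_of_isPlusPeriodWindowCovered
    (W₁ : WeierstrassCurve ℚ) [W₁.IsElliptic] (hopt : IsOptimalModel W₁)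
    (h : IsPlusPeriodWindowCovered W₁) : OptimalCurveManinCertificate W₁ :=
  ⟨hopt, classAbsManinConstantEqOne_of_isPlusPeriodWindowCovered W₁ h⟩

/-! ### Bridge to `PlusPeriodClassBound` (the sibling file's predicate of record) -/

/-- The upper half of the datum: (*) within `ε` gives `Ω(W₁) < (1 + ε) · Ω⁺_f` for every newform
`f` of `W₁` (`Ω⁺_f > 0` for the rational newform of an elliptic curve). Only this half is used
towards `c = 1`. [cite: AgasheRibetStein2006, appendix §5, (*) p. 632 and p. 634 L19–22] -/
theorem IsPlusPeriodCloseWithin.realPeriodRat_lt_mul_plusPeriod {ε : ℝ} {W₁ : WeierstrassCurve ℚ}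
    (h : IsPlusPeriodCloseWithin ε W₁) {N : ℕ} [NeZero N] (f : CuspForm (Gamma0 N) 2)
    (hf : IsNewformOf W₁ f) : W₁.realPeriodRat < (1 + ε) * plusPeriod f := by
  have hplus : 0 < plusPeriod f := IsNewform0.plusPeriod_pos_holds hf.1 hf.coeffField_eq_bot
  have h1 : W₁.realPeriodRat / plusPeriod f - 1 < ε := (abs_sub_lt_iff.mp (h f hf)).1
  have h2 : W₁.realPeriodRat / plusPeriod f < 1 + ε := by linarith
  exact (div_lt_iff₀ hplus).mp h2

/-- **Bridge (general window).** The two-piece display — datum (*) within `ε` for `W₁` and the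
class-side bound `Ω(W') ≤ r·Ω(W₁)` — gives the sibling file's one-piece predicate
`PlusPeriodClassBound W₁ u` for any natural `u` with `r(1+ε) ≤ u`:
`Ω(W') ≤ r·Ω(W₁) < r(1+ε)·Ω⁺_f ≤ u·Ω⁺_f`.
[cite: AgasheRibetStein2006, appendix §5, (*) and proof of Thm. 5.4 (p. 634)] -/
theorem plusPeriodClassBound_of_isPlusPeriodCloseWithin_of_isRealPeriodRatioLe
    {ε : ℝ} {r : ℚ} {u : ℕ} (hεr : (r : ℝ) * (1 + ε) ≤ u)
    (W₁ : WeierstrassCurve ℚ) [W₁.IsElliptic]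
    (hstar : IsPlusPeriodCloseWithin ε W₁) (hratio : IsRealPeriodRatioLe r W₁) :
    PlusPeriodClassBound W₁ u := by
  intro W' _ _ N' _ f hiso hf
  have hplus : 0 < plusPeriod f := IsNewform0.plusPeriod_pos_holds hf.1 hf.coeffField_eq_bot
  have hΩ' : 0 < W'.realPeriodRat := by
    haveI : (W'.baseChange ℝ).IsElliptic := by
      rw [WeierstrassCurve.baseChange]; infer_instance
    exact (W'.baseChange ℝ).realPeriod_pos'
  have hΩ₁ : 0 < W₁.realPeriodRat := by
    haveI : (W₁.baseChange ℝ).IsElliptic := by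
      rw [WeierstrassCurve.baseChange]; infer_instance
    exact (W₁.baseChange ℝ).realPeriod_pos'
  have h1 : W'.realPeriodRat ≤ (r : ℝ) * W₁.realPeriodRat := hratio W' hiso
  have h2 : W₁.realPeriodRat < (1 + ε) * plusPeriod f := hstar.realPeriodRat_lt_mul_plusPeriod f hf
  have hr : 0 < (r : ℝ) := by
    by_contra hle
    have : (r : ℝ) * W₁.realPeriodRat ≤ 0 :=
      mul_nonpos_of_nonpos_of_nonneg (not_lt.mp hle) hΩ₁.le
    linarith
  calc W'.realPeriodRat ≤ (r : ℝ) * W₁.realPeriodRat := h1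
    _ < (r : ℝ) * ((1 + ε) * plusPeriod f) := mul_lt_mul_of_pos_left h2 hr
    _ = ((r : ℝ) * (1 + ε)) * plusPeriod f := by ring
    _ ≤ (u : ℝ) * plusPeriod f := mul_le_mul_of_nonneg_right hεr hplus.le

/-- **Bridge (the road's name).** `IsPlusPeriodWindowCovered W₁ ⟹ PlusPeriodClassBound W₁ 2`
(`ε = 1/3`, `r = 1`, `r(1+ε) = 4/3 ≤ 2`): the two-piece printed display feeds the sibling file's
predicate of record. [cite: AgasheRibetStein2006, appendix Thm. 5.4 (p. 634 L7–44)] -/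
theorem IsPlusPeriodWindowCovered.plusPeriodClassBound_two {W₁ : WeierstrassCurve ℚ}
    [W₁.IsElliptic] (h : IsPlusPeriodWindowCovered W₁) : PlusPeriodClassBound W₁ 2 :=
  plusPeriodClassBound_of_isPlusPeriodCloseWithin_of_isRealPeriodRatioLe
    (ε := 1 / 3) (r := 1) (u := 2) (by norm_num) W₁ h.1 h.2

/-- The road's constructor RE-DERIVED through the sibling file (same statement as
`classAbsManinConstantEqOne_of_isPlusPeriodWindowCovered`; proof = bridge +
`classAbsManinConstantEqOne_of_plusPeriodClassBound_two`), recording that the two files prove one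
and the same thing. [cite: AgasheRibetStein2006, appendix Thm. 5.4 (p. 634 L7–44)] -/
theorem classAbsManinConstantEqOne_of_isPlusPeriodWindowCovered'
    (W₁ : WeierstrassCurve ℚ) [W₁.IsElliptic] (h : IsPlusPeriodWindowCovered W₁) :
    ClassAbsManinConstantEqOne W₁ :=
  classAbsManinConstantEqOne_of_plusPeriodClassBound_two W₁ h.plusPeriodClassBound_two

end Literature.NumberTheory.EllipticCurves.ModularForms

end
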